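import Literature.Probability.LatticeModels.SixVertexTwoPointSpectral
import Literature.Probability.LatticeModels.SixVertexCylinderMixing
import Literature.Probability.LatticeModels.SixVertexTorusIce

/-!
# Six-vertex model: the spectral measure `μ_L` and Theorem 23 for horizontally aligned pairs
# (DKLM 2026, Theorem 23: definition of `μ_L`, support, roots of unity, and the two-point
# formula for pairs `(u_i, u_i')` on horizontal lines via additivity)

H. Duminil-Copin, K. K. Kozlowski, P. Lammers, I. Manolescu, *Gaussian free field convergence of
the six-vertex model with `-1 ≤ Δ ≤ -1/2`*, arXiv:2603.06268 (2026) [DKLM2026SixVertexGFF]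
(`paper:arxiv-2603.06268`, chunks p0018, p0043–p0044):

> **Theorem 23.** […] there exists a finite positive measure `μ_L` on `ℝ_{>0} × ℝ` such that
> `Φ_{CYL_L,2}(u) = ∫ ((1-a)^{x₂} e^{-iby₂} - 1)(1-a)^{x₁'} e^{-iby₁'} (1 - (1-a)^{x₁} e^{-iby₁}) dμ_L(a,b)`
> for any horizontally ordered `u = (u₁,u₁',u₂,u₂') ⊂ ℝ²`, and which is supported on the set
> `(0,2] × [-π,π]` […]. Furthermore, `μ_L({|b| ∈ (0,2π/L)}) = 0`.
> *Proof.* `μ_L := ∑_{k>0} |v_k† S(π/2) v_0|² / (1-Λ_k(π/2))² δ_{(1-Λ_k(π/2), -i log Λ_k(0))}`.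
> The support of `μ_L` is contained in `(0,2) × [-π,π)`, since `|Λ_k(π/2)| < 1` for every `k > 0`.
> **Step 1.** […] `Φ_{CYL_L,2}(u)` can be written as a sum of two-point functions for `u` with
> `(u₁,u₁')` and `(u₂,u₂')` horizontally adjacent. The additivity property […] reduces the problem
> to […] this special case.

Building on `SixVertexTwoPointSpectral.lean` (Step 1 for adjacent pairs) and
`SixVertexCylinderMixing.lean` (bilinearity), for `a = b = 1`, `c > 0`, `L = 2(ℓ+1)`:

1. **The measure `μ_L` as a finite family of atoms** indexed by the joint eigenbasis:
   `dklmAtomA c ℓ k = a_k = 1 - λ_k/Λ`, phases `ω_k = transferJointPhase c ℓ k` (`e^{ib_k}`; the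
   source's `Λ_k(0)` is `ω̄_k` in our transposed indexing), weights
   `dklmWeight c hc ℓ k = |m_k|² / (Λ² a_k²)` for `k ≠ k₀` and `0` at the top index; properties:
   `dklmWeight_nonneg` (positivity), `dklmAtomA_mem_Ioo` (`a_k ∈ (0,2)` for `k ≠ k₀`: support in
   `(0,2) × [-π,π)`), `norm = 1` and `ω_k^L = 1` (so `b_k ∈ (2π/L)ℤ`: no mass on `|b| ∈ (0,2π/L)`).
2. Horizontal height differences as strip observables: `rowBlockObs r' a w' h y` reads
   `h(face a + w' + 1, y) - h(face a, y) = -∑_{i ≤ w'} α_y(column a + i)` inside a strip of `r'+1`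
   columns; the torus-level expansion of a pair of them into shifted vertical-arrow pairs
   (`torusPairExp_rowBlockObs`, using the horizontal shift invariance `torusCondExp_comp_shift`
   and linearity), hence `cylinderPairExp_rowBlockObs` (the additivity of Step 1).
3. **Theorem 23 for horizontally aligned pairs**: `cylinderPairExp_rowBlockObs_eq_sum` —
   for blocks of `x₁ = w₁'+1` and `x₂ = w₂'+1` columns at horizontal distance
   `x₁' = (r₁' - a₁ - w₁') + k + a₂` and rows `y₁, y₂`,
   `Φ_{CYL_L,2} = ∑_k w_k ((1-a_k)^{x₂} - 1) (1-a_k)^{x₁'} ω_k^{y₁} ω̄_k^{y₂} (1 - (1-a_k)^{x₁})`,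
   i.e. the printed formula with `e^{-ib y₁'} = ω^{y(u₁)} ω̄^{y(u₂)}`, `y₁ = y₂ = 0` inside the pairs.

## References

* H. Duminil-Copin, K. K. Kozlowski, P. Lammers, I. Manolescu, arXiv:2603.06268 (2026), Theorem 23
  and its proof (definition of `μ_L`, Step 1, Step 3). [DKLM2026SixVertexGFF]
-/

noncomputable section

open Finset Matrix Filter Topology
open Literature.LinearAlgebra.Matrix

namespace Literature.Probability.LatticeModels.SixVertex

/-! ## 1. The atoms, phases and weights of `μ_L` -/

section Measure

variable (c : ℝ) (hc : 0 < c) (ℓ : ℕ)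

/-- **The atoms `a_k = 1 - λ_k(π/2)/Λ`** of `μ_L` (first coordinate; `Λ_k(π/2) = λ_k/Λ`).
[cite: DKLM2026SixVertexGFF, proof of Theorem 23 (def. of `μ_L`)] -/
def dklmAtomA (k : {κ : ZMod (2 * (ℓ + 1)) → Bool // IsBalancedCol κ}) : ℝ :=
  1 - transferJointEigenvalue c ℓ k /
    topEigenvalue (balancedTransferMatrix_isHermitian (G₂ := ZMod (2 * (ℓ + 1))) 1 c)

include hc in
/-- **Support in `(0, 2)`**: `a_k ∈ (0, 2)` for `k ≠ k₀` ("since `|Λ_k(π/2)| < 1` for every `k > 0`").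
[cite: DKLM2026SixVertexGFF, Theorem 23 and its proof] -/
theorem dklmAtomA_mem_Ioo {k : {κ : ZMod (2 * (ℓ + 1)) → Bool // IsBalancedCol κ}} (hk : k ≠ topIdx c hc ℓ) :
    dklmAtomA c ℓ k ∈ Set.Ioo (0 : ℝ) 2 := by
  obtain ⟨δ, hδ, hdiag⟩ := exists_balancedTransferMatrix_diag_ge (G₂ := ZMod (2 * (ℓ + 1))) c hc
  have hΛ := topEigenvalue_pos_of_diag (balancedTransferMatrix_isHermitian (G₂ := ZMod (2 * (ℓ + 1))) 1 c)
    hδ hdiag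
  have h := abs_transferJointEigenvalue_lt_top c hc ℓ hk
  rw [abs_lt] at h
  unfold dklmAtomA
  constructor
  · rw [sub_pos, div_lt_one hΛ]; exact h.2
  · have : -1 < transferJointEigenvalue c ℓ k /
        topEigenvalue (balancedTransferMatrix_isHermitian (G₂ := ZMod (2 * (ℓ + 1))) 1 c) := by
      rw [lt_div_iff₀ hΛ]; linarith
    linarith

include hc in
/-- `a_{k₀} = 0` (the top index carries no atom of `μ_L`; its weight is `0`). [cite: DKLM2026SixVertexGFF, proof of Theorem 23] -/
theorem dklmAtomA_topIdx : dklmAtomA c ℓ (topIdx c hc ℓ) = 0 := by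
  obtain ⟨δ, hδ, hdiag⟩ := exists_balancedTransferMatrix_diag_ge (G₂ := ZMod (2 * (ℓ + 1))) c hc
  have hΛ := topEigenvalue_pos_of_diag (balancedTransferMatrix_isHermitian (G₂ := ZMod (2 * (ℓ + 1))) 1 c)
    hδ hdiag
  unfold dklmAtomA
  rw [transferJointEigenvalue_topIdx, div_self hΛ.ne', sub_self]

/-- **The weights `w_k = |v_k† S v_0|² / (1 - Λ_k(π/2))²`** of `μ_L`: `|m_k|² / (Λ² a_k²)` off the top
index, `0` at the top index. [cite: DKLM2026SixVertexGFF, proof of Theorem 23 (def. of `μ_L`)] -/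
def dklmWeight (k : {κ : ZMod (2 * (ℓ + 1)) → Bool // IsBalancedCol κ}) : ℝ :=
  if k = topIdx c hc ℓ then 0 else
    Complex.normSq (topArrowCoeff c hc ℓ k) /
      (topEigenvalue (balancedTransferMatrix_isHermitian (G₂ := ZMod (2 * (ℓ + 1))) 1 c) ^ 2 *
        dklmAtomA c ℓ k ^ 2)

/-- **`μ_L` is a positive measure**: `w_k ≥ 0`. [cite: DKLM2026SixVertexGFF, Theorem 23] -/
theorem dklmWeight_nonneg (k : {κ : ZMod (2 * (ℓ + 1)) → Bool // IsBalancedCol κ}) : 0 ≤ dklmWeight c hc ℓ k := by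
  unfold dklmWeight
  split_ifs
  · exact le_rfl
  · exact div_nonneg (Complex.normSq_nonneg _) (mul_nonneg (sq_nonneg _) (sq_nonneg _))

/-- The weight times `a_k²` recovers `|m_k|²/Λ²` (also at the top index, where both vanish).
[cite: DKLM2026SixVertexGFF, proof of Theorem 23, Step 1] -/
theorem dklmWeight_mul_sq (k : {κ : ZMod (2 * (ℓ + 1)) → Bool // IsBalancedCol κ}) :
    dklmWeight c hc ℓ k * dklmAtomA c ℓ k ^ 2 =
      Complex.normSq (topArrowCoeff c hc ℓ k) /
        topEigenvalue (balancedTransferMatrix_isHermitian (G₂ := ZMod (2 * (ℓ + 1))) 1 c) ^ 2 := by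
  unfold dklmWeight
  split_ifs with h
  · rw [h, topArrowCoeff_topIdx, map_zero, zero_div, zero_mul]
  · have ha : dklmAtomA c ℓ k ≠ 0 := (dklmAtomA_mem_Ioo c hc ℓ h).1.ne'
    field_simp

end Measure

/-! ## 2. Horizontal shift invariance of the balanced torus expectation -/

section Shift

variable {G₁ G₂ : Type*} [AddCommGroup G₁] [AddCommGroup G₂] [One G₁] [One G₂] [Fintype G₁] [Fintype G₂]
  [DecidableEq G₁] [DecidableEq G₂]

/-- **Translation invariance of `𝔼_{𝕋}[· | balanced]`**: `𝔼[F ∘ shift_t] = 𝔼[F]`.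
[cite: DKLM2026SixVertexGFF, Cor. 56 (5) ("horizontal shift-invariance")] -/
theorem torusCondExp_comp_shift (a b c : ℝ) (t : G₁ × G₂) (F : Config (G₁ × G₂) → ℝ) :
    torusCondExp a b c (fun ω => F (fun w' => ω (w' + t))) = torusCondExp a b c F := by
  classical
  let Φ : Config (G₁ × G₂) ≃ Config (G₁ × G₂) :=
    ⟨fun ω w' => ω (w' + t), fun ω w' => ω (w' - t),
      fun ω => funext fun w' => by simp, fun ω => funext fun w' => by simp⟩
  have hnum : (∑ ω : Config (G₁ × G₂),
      if IsBalanced ω then F (fun w' => ω (w' + t)) * torusWeight a b c ω else 0) =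
      ∑ ω : Config (G₁ × G₂), if IsBalanced ω then F ω * torusWeight a b c ω else 0 := by
    rw [← Equiv.sum_comp Φ (fun ω => if IsBalanced ω then F ω * torusWeight a b c ω else 0)]
    refine Finset.sum_congr rfl fun ω _ => ?_
    have hΦω : (Φ ω : Config (G₁ × G₂)) = fun w' => ω (w' + t) := rfl
    rw [hΦω]
    by_cases h : IsBalanced ω
    · rw [if_pos h, if_pos ((isBalanced_shift_iff ω t).2 h), torusWeight_shift]
    · rw [if_neg h, if_neg (fun h' => h ((isBalanced_shift_iff ω t).1 h'))]
  unfold torusCondExp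
  beta_reduce
  rw [hnum]

/-- `𝔼_{𝕋}[· | balanced]` of a finite sum. [folklore] -/
theorem torusCondExp_finset_sum {ι : Type*} (a b c : ℝ) (s : Finset ι) (F : ι → Config (G₁ × G₂) → ℝ) :
    torusCondExp a b c (fun ω => ∑ i ∈ s, F i ω) = ∑ i ∈ s, torusCondExp a b c (F i) := by
  classical
  induction s using Finset.induction_on with
  | empty =>
    simp only [Finset.sum_empty]
    unfold torusCondExp
    simp
  | insert i s hi ih =>
    rw [Finset.sum_insert hi, ← ih]
    have h : (fun ω => ∑ j ∈ insert i s, F j ω) = F i + fun ω => ∑ j ∈ s, F j ω := by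
      funext ω
      rw [Finset.sum_insert hi]
      rfl
    rw [h, torusCondExp_add]

end Shift

/-! ## 3. Horizontal height differences (row blocks) and their pair correlations -/

section RowBlock

variable {G₂ : Type*} [AddCommGroup G₂] [One G₂] [Fintype G₂] [DecidableEq G₂]

/-- **A horizontal height difference inside a strip**: on a strip of `r'+1` vertex columns, the
observable `h(face a + w' + 1, y) - h(face a, y) = -∑_{i ≤ w'} α_y(column a + i)` (each unit step
east changes the height by `-1` if the crossed vertical arrow points north, `+1` otherwise,
Def. 2.3); `a = 0`, `w' = r'` is the difference across the whole strip.
[cite: DKLM2026SixVertexGFF, Def. 2.3 and proof of Theorem 23, Step 1] -/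
def rowBlockObs (r' a w' : ℕ) (h : a + w' + 1 ≤ r' + 1) (y : G₂) :
    (G₂ → Bool) → (Fin (r' + 1) → G₂ → Bool) → (Fin (r' + 1) → G₂ → Bool) → ℝ :=
  fun _ _ α => -∑ i : Fin (w' + 1), arrowSign (α ⟨a + (i : ℕ), by have := i.2; omega⟩ y)

omit [AddCommGroup G₂] [One G₂] [Fintype G₂] [DecidableEq G₂] in
/-- The torus reading of a row block. [folklore] -/
theorem torusObs_rowBlockObs {M : ℕ} (r' a w' : ℕ) (h : a + w' + 1 ≤ r' + 1) (y : G₂) (ω : Config (ZMod M × G₂)) :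
    torusObs r' (rowBlockObs r' a w' h y) ω =
      -∑ i : Fin (w' + 1), arrowSign ((ω (((a + (i : ℕ) : ℕ) : ZMod M), y)).2) := rfl

omit [AddCommGroup G₂] [One G₂] [Fintype G₂] [DecidableEq G₂] in
/-- The torus reading of a single vertical arrow. [folklore] -/
theorem torusObs_arrowObs {M : ℕ} (y : G₂) (ω : Config (ZMod M × G₂)) :
    torusObs 0 (arrowObs y) ω = arrowSign ((ω ((0 : ZMod M), y)).2) := by
  simp [torusObs, arrowObs, arrowSign]

omit [One G₂] [Fintype G₂] [DecidableEq G₂] in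
/-- **A pair of vertical arrows at columns `i` and `i + n`, read through a shift by `i`.**
[folklore] -/
theorem torusPairObs_arrowObs_shift {M : ℕ} (y₁ y₂ : G₂) (i n : ℕ) (ω : Config (ZMod M × G₂)) :
    torusPairObs 0 (arrowObs y₁) n 0 (arrowObs y₂) (fun w => ω (w + (((i : ℕ) : ZMod M), 0))) =
      arrowSign ((ω (((i : ℕ) : ZMod M), y₁)).2) * arrowSign ((ω (((i : ℕ) : ZMod M) + n, y₂)).2) := by
  unfold torusPairObs
  rw [torusObs_arrowObs, torusObs_arrowObs]
  simp only [Prod.mk_add_mk, zero_add, add_zero]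
  rw [add_comm ((n : ℕ) : ZMod M) ((i : ℕ) : ZMod M)]

/-- **Expansion of a pair of row blocks into pairs of vertical arrows on the torus**: for the
blocks at columns `a₁ + i` (`i ≤ w₁'`) and `n + a₂ + j` (`j ≤ w₂'`), `n ≥ r₁' + 1`,
`𝔼_{𝕋}[X · τ_n Y | bal] = ∑_{i} ∑_{j} 𝔼_{𝕋}[α_{y₁} · τ_{n + a₂ + j - (a₁ + i)} α_{y₂} | bal]`
(multiply out and use translation invariance). [cite: DKLM2026SixVertexGFF, proof of Theorem 23, Step 1 (additivity)] -/
theorem torusPairExp_rowBlockObs (c : ℝ) (M : ℕ) {r₁' r₂' : ℕ} (a₁ w₁' : ℕ) (h₁ : a₁ + w₁' + 1 ≤ r₁' + 1)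
    (a₂ w₂' : ℕ) (h₂ : a₂ + w₂' + 1 ≤ r₂' + 1) (y₁ y₂ : G₂) (n : ℕ) (hn : r₁' + 1 ≤ n) :
    torusPairExp c M r₁' (rowBlockObs r₁' a₁ w₁' h₁ y₁) n r₂' (rowBlockObs r₂' a₂ w₂' h₂ y₂) =
      ∑ i : Fin (w₁' + 1), ∑ j : Fin (w₂' + 1),
        torusPairExp c M 0 (arrowObs y₁) (n + a₂ + j - (a₁ + i)) 0 (arrowObs y₂) := by
  unfold torusPairExp
  split_ifs with hM
  · simp
  · haveI : NeZero M := ⟨hM⟩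
    have hexp : torusPairObs (M := M) r₁' (rowBlockObs r₁' a₁ w₁' h₁ y₁) n r₂' (rowBlockObs r₂' a₂ w₂' h₂ y₂) =
        fun ω => ∑ i : Fin (w₁' + 1), ∑ j : Fin (w₂' + 1),
          torusPairObs 0 (arrowObs y₁) (n + a₂ + j - (a₁ + i)) 0 (arrowObs y₂)
            (fun w => ω (w + ((((a₁ + (i : ℕ) : ℕ)) : ZMod M), 0))) := by
      funext ω
      rw [show torusPairObs (M := M) r₁' (rowBlockObs r₁' a₁ w₁' h₁ y₁) n r₂' (rowBlockObs r₂' a₂ w₂' h₂ y₂) ω =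
          torusObs r₁' (rowBlockObs r₁' a₁ w₁' h₁ y₁) ω *
            torusObs r₂' (rowBlockObs r₂' a₂ w₂' h₂ y₂) (fun v => ω (v + (((n : ℕ) : ZMod M), 0))) from rfl,
        torusObs_rowBlockObs, torusObs_rowBlockObs, neg_mul_neg, Finset.sum_mul_sum]
      simp only [torusPairObs_arrowObs_shift, Prod.mk_add_mk, add_zero]
      refine Finset.sum_congr rfl fun i _ => Finset.sum_congr rfl fun j _ => ?_
      have hi := i.2
      have hle : a₁ + (i : ℕ) ≤ n + a₂ + j := by omega
      rw [show ((((a₂ + (j : ℕ) : ℕ)) : ZMod M)) + ((n : ℕ) : ZMod M) =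
          ((((a₁ + (i : ℕ) : ℕ)) : ZMod M)) + (((n + a₂ + j - (a₁ + i) : ℕ) : ℕ) : ZMod M) by
        push_cast [Nat.cast_sub hle]; ring]
    rw [hexp, torusCondExp_finset_sum]
    refine Finset.sum_congr rfl fun i _ => ?_
    rw [torusCondExp_finset_sum]
    refine Finset.sum_congr rfl fun j _ => ?_
    exact torusCondExp_comp_shift 1 1 c (((((a₁ + (i : ℕ) : ℕ)) : ZMod M)), (0 : G₂)) _

variable [Nonempty {κ : G₂ → Bool // IsBalancedCol κ}]

/-- **Additivity on the cylinder**: for the gap `k ≥ 0` between the strips,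
`𝔼_{CYL_L}[X · τ Y] = ∑_{i} ∑_{j} 𝔼_{CYL_L}[α_{y₁} · τ_{(1 + ((r₁' - a₁ - i) + k + a₂ + j), 0)} α_{y₂}]`.
[cite: DKLM2026SixVertexGFF, proof of Theorem 23, Step 1 (additivity)] -/
theorem cylinderPairExp_rowBlockObs (c : ℝ) (hc : 0 < c) {r₁' r₂' : ℕ} (a₁ w₁' : ℕ) (h₁ : a₁ + w₁' + 1 ≤ r₁' + 1)
    (a₂ w₂' : ℕ) (h₂ : a₂ + w₂' + 1 ≤ r₂' + 1) (y₁ y₂ : G₂) (k : ℕ) :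
    cylinderPairExp c r₁' (rowBlockObs r₁' a₁ w₁' h₁ y₁) (r₁' + 1 + k) r₂' (rowBlockObs r₂' a₂ w₂' h₂ y₂) =
      ∑ i : Fin (w₁' + 1), ∑ j : Fin (w₂' + 1),
        cylinderPairExp c 0 (arrowObs y₁) (0 + 1 + ((r₁' - a₁ - i) + k + a₂ + j)) 0 (arrowObs y₂) := by
  have hlim := tendsto_torusPairExp_cylinderPairExp c hc (rowBlockObs r₁' a₁ w₁' h₁ y₁) (rowBlockObs r₂' a₂ w₂' h₂ y₂) k
  have hsum : Tendsto (fun M : ℕ => ∑ i : Fin (w₁' + 1), ∑ j : Fin (w₂' + 1),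
      torusPairExp c M 0 (arrowObs y₁) (0 + 1 + ((r₁' - a₁ - i) + k + a₂ + j)) 0 (arrowObs y₂)) atTop
      (𝓝 (∑ i : Fin (w₁' + 1), ∑ j : Fin (w₂' + 1),
        cylinderPairExp c 0 (arrowObs y₁) (0 + 1 + ((r₁' - a₁ - i) + k + a₂ + j)) 0 (arrowObs y₂))) :=
    tendsto_finsetSum _ fun i _ => tendsto_finsetSum _ fun j _ =>
      tendsto_torusPairExp_cylinderPairExp c hc (arrowObs y₁) (arrowObs y₂) _
  refine tendsto_nhds_unique hlim (hsum.congr fun M => ?_)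
  rw [torusPairExp_rowBlockObs c M a₁ w₁' h₁ a₂ w₂' h₂ y₁ y₂ (r₁' + 1 + k) (by omega)]
  refine Finset.sum_congr rfl fun i _ => Finset.sum_congr rfl fun j _ => ?_
  have hi := i.2
  rw [show r₁' + 1 + k + a₂ + (j : ℕ) - (a₁ + (i : ℕ)) = 0 + 1 + ((r₁' - a₁ - i) + k + a₂ + j) by omega]

end RowBlock

/-! ## 4. Theorem 23 for horizontally aligned pairs -/

section AlignedPairs

/-- A geometric sum over `Fin (p+1)` in reflected form: `∑_{i ≤ p} r^{p-i} = ∑_{i ≤ p} r^i`. [folklore] -/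
theorem sum_pow_sub_eq (r : ℂ) (p : ℕ) : ∑ i : Fin (p + 1), r ^ (p - (i : ℕ)) = ∑ i : Fin (p + 1), r ^ (i : ℕ) := by
  rw [Fin.sum_univ_eq_sum_range (fun i => r ^ (p - i)) (p + 1), Fin.sum_univ_eq_sum_range (fun i => r ^ i) (p + 1)]
  rw [← Finset.sum_range_reflect (fun i => r ^ i) (p + 1)]
  refine Finset.sum_congr rfl fun i hi => ?_
  rw [Finset.mem_range] at hi
  rw [show p + 1 - 1 - i = p - i by omega]

/-- `a ∑_{i ≤ p} (1-a)^i = 1 - (1-a)^{p+1}`. [folklore] -/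
theorem mul_geom_sum_one_sub (a : ℂ) (p : ℕ) : a * ∑ i : Fin (p + 1), (1 - a) ^ (i : ℕ) = 1 - (1 - a) ^ (p + 1) := by
  rw [Fin.sum_univ_eq_sum_range (fun i => (1 - a) ^ i) (p + 1)]
  have h := geom_sum_mul (1 - a) (p + 1)
  -- `(∑ x^i) (x - 1) = x^n - 1` with `x = 1 - a`
  have h2 : (∑ i ∈ Finset.range (p + 1), (1 - a) ^ i) * (1 - a - 1) = (1 - a) ^ (p + 1) - 1 := h
  linear_combination -h2

variable (c : ℝ) (hc : 0 < c) (ℓ : ℕ)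

include hc

/-- **Theorem 23 for horizontally aligned pairs.** For `c > 0`, `L = 2(ℓ+1)`, a pair
`(u₁, u₁')` on the row `y₁` spanning the `x₁ = w₁'+1` vertex columns `a₁, …, a₁ + w₁'` of a strip of
`r₁'+1` columns, and a pair `(u₂, u₂')` on the row `y₂` spanning the `x₂ = w₂'+1` columns
`a₂, …, a₂ + w₂'` of a second strip placed after a gap of `k` columns, so that the horizontal
distance between the pairs is `x₁' = (r₁' - a₁ - w₁') + k + a₂`:
`Φ_{CYL_L,2}(u) = ∑_k w_k ((1-a_k)^{x₂} - 1) (1-a_k)^{x₁'} ω_k^{y₁} ω̄_k^{y₂} (1 - (1-a_k)^{x₁})`,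
the printed `∫ ((1-a)^{x₂} e^{-iby₂} - 1)(1-a)^{x₁'} e^{-iby₁'} (1 - (1-a)^{x₁} e^{-iby₁}) dμ_L(a,b)`
with `y₁ = y₂ = 0` inside the pairs and `e^{-ib y₁'} = ω^{y(u₁)} ω̄^{y(u₂)}`.
[cite: DKLM2026SixVertexGFF, Theorem 23 (horizontally aligned pairs, Step 1 of its proof)] -/
theorem cylinderPairExp_rowBlockObs_eq_sum {r₁' r₂' : ℕ} (a₁ w₁' : ℕ) (h₁ : a₁ + w₁' + 1 ≤ r₁' + 1)
    (a₂ w₂' : ℕ) (h₂ : a₂ + w₂' + 1 ≤ r₂' + 1) (y₁ y₂ k : ℕ) :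
    ((cylinderPairExp c r₁' (rowBlockObs r₁' a₁ w₁' h₁ ((y₁ : ℕ) : ZMod (2 * (ℓ + 1)))) (r₁' + 1 + k) r₂'
        (rowBlockObs r₂' a₂ w₂' h₂ ((y₂ : ℕ) : ZMod (2 * (ℓ + 1)))) : ℝ) : ℂ) =
      ∑ j, (dklmWeight c hc ℓ j : ℂ) * ((1 - (dklmAtomA c ℓ j : ℂ)) ^ (w₂' + 1) - 1) *
        (1 - (dklmAtomA c ℓ j : ℂ)) ^ ((r₁' - a₁ - w₁') + k + a₂) * transferJointPhase c ℓ j ^ y₁ *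
        star (transferJointPhase c ℓ j) ^ y₂ * (1 - (1 - (dklmAtomA c ℓ j : ℂ)) ^ (w₁' + 1)) := by
  set Λ := topEigenvalue (balancedTransferMatrix_isHermitian (G₂ := ZMod (2 * (ℓ + 1))) 1 c) with hΛdef
  obtain ⟨δ, hδ, hdiag⟩ := exists_balancedTransferMatrix_diag_ge (G₂ := ZMod (2 * (ℓ + 1))) c hc
  have hΛ : 0 < Λ := topEigenvalue_pos_of_diag _ hδ hdiag
  have hΛC : (Λ : ℂ) ≠ 0 := by exact_mod_cast hΛ.ne'
  -- additivity, then Step 1 termwise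
  rw [cylinderPairExp_rowBlockObs c hc, Complex.ofReal_sum]
  simp only [Complex.ofReal_sum, cylinderPairExp_arrowObs_eq c hc ℓ]
  -- `λ_j = Λ (1 - a_j)`
  have hlam : ∀ j, ((transferJointEigenvalue c ℓ j : ℝ) : ℂ) = (Λ : ℂ) * (1 - (dklmAtomA c ℓ j : ℂ)) := by
    intro j
    unfold dklmAtomA
    rw [← hΛdef]
    push_cast
    field_simp
    ring
  simp only [hlam]
  -- exponent bookkeeping: `r₁' - a₁ - i = (r₁' - a₁ - w₁') + (w₁' - i)` for `i ≤ w₁'`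
  have hexp : ∀ i : Fin (w₁' + 1), r₁' - a₁ - (i : ℕ) = (r₁' - a₁ - w₁') + (w₁' - (i : ℕ)) := by
    intro i; have := i.2; omega
  -- per-atom identity
  have perj : ∀ j : {κ : ZMod (2 * (ℓ + 1)) → Bool // IsBalancedCol κ},
      ∑ i : Fin (w₁' + 1), ∑ jj : Fin (w₂' + 1),
        -((Complex.normSq (topArrowCoeff c hc ℓ j) : ℂ) *
              ((Λ : ℂ) * (1 - (dklmAtomA c ℓ j : ℂ))) ^ (r₁' - a₁ - (i : ℕ) + k + a₂ + jj) *
            transferJointPhase c ℓ j ^ y₁ * star (transferJointPhase c ℓ j) ^ y₂) /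
          (Λ : ℂ) ^ (r₁' - a₁ - (i : ℕ) + k + a₂ + jj + 2) =
      (dklmWeight c hc ℓ j : ℂ) * ((1 - (dklmAtomA c ℓ j : ℂ)) ^ (w₂' + 1) - 1) *
        (1 - (dklmAtomA c ℓ j : ℂ)) ^ ((r₁' - a₁ - w₁') + k + a₂) * transferJointPhase c ℓ j ^ y₁ *
        star (transferJointPhase c ℓ j) ^ y₂ * (1 - (1 - (dklmAtomA c ℓ j : ℂ)) ^ (w₁' + 1)) := by
    intro j
    set a : ℂ := (dklmAtomA c ℓ j : ℂ) with ha
    set N : ℂ := (Complex.normSq (topArrowCoeff c hc ℓ j) : ℂ) with hN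
    set φ : ℂ := transferJointPhase c ℓ j ^ y₁ * star (transferJointPhase c ℓ j) ^ y₂ with hφ
    have hw : (dklmWeight c hc ℓ j : ℂ) * a ^ 2 = N / (Λ : ℂ) ^ 2 := by
      rw [ha, hN]
      exact_mod_cast dklmWeight_mul_sq c hc ℓ j
    have hstep : ∀ (i : Fin (w₁' + 1)) (jj : Fin (w₂' + 1)),
        -(N * ((Λ : ℂ) * (1 - a)) ^ (r₁' - a₁ - (i : ℕ) + k + a₂ + jj) * transferJointPhase c ℓ j ^ y₁ *
            star (transferJointPhase c ℓ j) ^ y₂) / (Λ : ℂ) ^ (r₁' - a₁ - (i : ℕ) + k + a₂ + jj + 2) =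
          -(N / (Λ : ℂ) ^ 2 * φ * (1 - a) ^ ((r₁' - a₁ - w₁') + k + a₂)) *
            ((1 - a) ^ (w₁' - (i : ℕ)) * (1 - a) ^ (jj : ℕ)) := by
      intro i jj
      have hE : (1 - a) ^ (r₁' - a₁ - w₁' + (w₁' - (i : ℕ)) + k + a₂ + (jj : ℕ)) =
          (1 - a) ^ ((r₁' - a₁ - w₁') + k + a₂) * ((1 - a) ^ (w₁' - (i : ℕ)) * (1 - a) ^ (jj : ℕ)) := by
        rw [← pow_add, ← pow_add]
        congr 1
        omega
      rw [hφ, hexp i, mul_pow, pow_add (Λ : ℂ) _ 2, hE]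
      field_simp
    simp only [hstep, ← Finset.mul_sum]
    rw [← Finset.sum_mul, sum_pow_sub_eq, ← hw]
    have g1 := mul_geom_sum_one_sub a w₁'
    have g2 := mul_geom_sum_one_sub a w₂'
    calc -(↑(dklmWeight c hc ℓ j) * a ^ 2 * φ * (1 - a) ^ ((r₁' - a₁ - w₁') + k + a₂)) *
          ((∑ i : Fin (w₁' + 1), (1 - a) ^ (i : ℕ)) * ∑ i : Fin (w₂' + 1), (1 - a) ^ (i : ℕ))
        = -(↑(dklmWeight c hc ℓ j) * φ * (1 - a) ^ ((r₁' - a₁ - w₁') + k + a₂)) *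
            ((a * ∑ i : Fin (w₁' + 1), (1 - a) ^ (i : ℕ)) * (a * ∑ i : Fin (w₂' + 1), (1 - a) ^ (i : ℕ))) := by ring
      _ = _ := by rw [g1, g2, hφ]; ring
  -- assemble: push the division inside, exchange the sums
  calc (∑ i : Fin (w₁' + 1), ∑ jj : Fin (w₂' + 1),
        -(∑ j, (Complex.normSq (topArrowCoeff c hc ℓ j) : ℂ) *
              ((Λ : ℂ) * (1 - (dklmAtomA c ℓ j : ℂ))) ^ (r₁' - a₁ - (i : ℕ) + k + a₂ + jj) *
            transferJointPhase c ℓ j ^ y₁ * star (transferJointPhase c ℓ j) ^ y₂) /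
          (Λ : ℂ) ^ (r₁' - a₁ - (i : ℕ) + k + a₂ + jj + 2))
      = ∑ i : Fin (w₁' + 1), ∑ jj : Fin (w₂' + 1), ∑ j,
          -((Complex.normSq (topArrowCoeff c hc ℓ j) : ℂ) *
                ((Λ : ℂ) * (1 - (dklmAtomA c ℓ j : ℂ))) ^ (r₁' - a₁ - (i : ℕ) + k + a₂ + jj) *
              transferJointPhase c ℓ j ^ y₁ * star (transferJointPhase c ℓ j) ^ y₂) /
            (Λ : ℂ) ^ (r₁' - a₁ - (i : ℕ) + k + a₂ + jj + 2) := by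
        refine Finset.sum_congr rfl fun i _ => Finset.sum_congr rfl fun jj _ => ?_
        rw [← Finset.sum_neg_distrib, Finset.sum_div]
    _ = ∑ i : Fin (w₁' + 1), ∑ j, ∑ jj : Fin (w₂' + 1),
          -((Complex.normSq (topArrowCoeff c hc ℓ j) : ℂ) *
                ((Λ : ℂ) * (1 - (dklmAtomA c ℓ j : ℂ))) ^ (r₁' - a₁ - (i : ℕ) + k + a₂ + jj) *
              transferJointPhase c ℓ j ^ y₁ * star (transferJointPhase c ℓ j) ^ y₂) /
            (Λ : ℂ) ^ (r₁' - a₁ - (i : ℕ) + k + a₂ + jj + 2) :=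
        Finset.sum_congr rfl fun i _ => Finset.sum_comm
    _ = ∑ j, ∑ i : Fin (w₁' + 1), ∑ jj : Fin (w₂' + 1),
          -((Complex.normSq (topArrowCoeff c hc ℓ j) : ℂ) *
                ((Λ : ℂ) * (1 - (dklmAtomA c ℓ j : ℂ))) ^ (r₁' - a₁ - (i : ℕ) + k + a₂ + jj) *
              transferJointPhase c ℓ j ^ y₁ * star (transferJointPhase c ℓ j) ^ y₂) /
            (Λ : ℂ) ^ (r₁' - a₁ - (i : ℕ) + k + a₂ + jj + 2) := Finset.sum_comm
    _ = _ := Finset.sum_congr rfl fun j _ => perj j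

end AlignedPairs

end Literature.Probability.LatticeModels.SixVertex

end
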